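import Literature.AlgebraicTopology.SingularHomology.LocallyFlatPairMapBox
import Literature.AlgebraicTopology.SingularHomology.LocallyFlatCriticalDegree
import Literature.AlgebraicTopology.SingularHomology.KroneckerPairingLocality
import Literature.AlgebraicTopology.SingularHomology.UniversalCoefficientsField
import HarnessLib

/-!
# Transport of the topological Thom line along a map which is a local homeomorphism at one point of the stratum

Stub `stub_thomLineTransport` of the line `andre_motivated_split` for the crux `HodgeBeyondAnchors`
(stmt-HodgeConjecture-14054): the pure-topology heart (T) of the cone step of Chow's moving lemma
read in singular (co)homology — "`Z` appears with multiplicity ONE in `φ⁻¹(φ Z)`" (C. Voisin, *Hodge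
Theory and Complex Algebraic Geometry II* (2003), §9.2.4, proof of Lemma 9.22; W. Fulton,
*Intersection Theory* §19.1 eq. (3) and Lemma 19.1.1: `H²ᶜ(X, X − V)` is free of rank one on the
class of `V`; A. Hatcher, *Algebraic Topology* (2002), §3.3 Lemma 3.27 and proof of Thm. 3.35).

Setting. `Ω ⊆ A`, `Ω' ⊆ A'` open in second-countable spaces, `Φ : A → A'` continuous with
`Φ Ω ⊆ Ω'`, `Z ⊆ A`, `C ⊆ A'` closed with `Φ Z ⊆ C` and `Ω ∩ Φ⁻¹ C ⊆ Z`; `Ω ∩ Z`, `Ω' ∩ C`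
preconnected and straightened by charts of normal real dimension `≥ k ≥ 2`; `Φ` agrees with an open
partial homeomorphism `e₀ : A ⇀ A'` near a point `P ∈ Ω ∩ Z ∩ e₀.source`. Conclusion: for every
NON-ZERO `b ∈ Hᵏ(Ω'; 𝕜)` dying on `Ω' ∖ C`, the classes of `Hᵏ(Ω; 𝕜)` dying on `Ω ∖ Z` are the
multiples of `(Φ|_Ω)^* b`.

Proof (everything PROVED, in three steps):

* `surjective_relMap_of_homeomorph_box` — if a subset `B ⊆ U` is carried by `f : U → U'`
  homeomorphically onto a BOX `B'` of a straightening chart of the closed, preconnected, locally flat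
  `S' ⊆ U'` (normal dimension `≥ k ≥ 2`), compatibly with `S = f⁻¹ S'`, then the pair map
  `f_* : H_k(U | S) → H_k(U' | S')` is ONTO: the range of the box `B'` is everything
  (`range_toAmbient_box_eq_top`) and it factors through `f_*` (`relativeSingularHomology.map_comp`,
  `relativeSingularHomology.bijective_map_homeomorph`);
* `ker_cohomologyMap_le_span_map_of_surjective` — the Kronecker functional argument (Hatcher §3.1
  Thm. 3.2 over a field, `kroneckerPairing_injective_of_field`): if `H_k(U | S) = 𝕜 · θ`, `f_*` is
  onto `H_k(U' | S')` and `b ≠ 0` dies on `U' ∖ S'`, then every class of `Hᵏ(U)` dying on `U ∖ S` is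
  a multiple of `f^* b` — both functionals `⟨x, –⟩` and `⟨f^* b, –⟩ = ⟨b, f_* –⟩` factor through the
  image of `H_k(U)` in the line `H_k(U | S)` (`relativeSingularHomology.exact_map_ofAbsolute`,
  `ofAbsolute_comp_map`), the latter with a non-zero coefficient since otherwise `⟨b, –⟩ = 0`;
* `stub_thomLineTransport` — in the setting above, with `U = Ω`, `U' = Ω'`, `S = Ω ∩ Z`,
  `S' = Ω' ∩ C` read in the subspaces (the ambient charts restrict, `OpenPartialHomeomorph.subtypeRestr`):
  a small box `B'` of the straightening chart of `C` at `Φ P = e₀ P`, inside the open set where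
  `e₀⁻¹` lands in `Ω` (`exists_box_subset`), is the homeomorphic image under `Φ` of
  `B = e₀.source ∩ Φ⁻¹ B'`, with inverse `e₀⁻¹`.

## References

* [VoisinHodgeII2003] C. Voisin, Hodge Theory and Complex Algebraic Geometry II, CUP 2003, §9.2.4
  proof of Lemma 9.22.
* [HatcherAT2002] A. Hatcher, Algebraic Topology, CUP 2002, §3.1 Thm. 3.2, §3.3 Lemma 3.27 and proof
  of Thm. 3.35, §2.1 Prop. 2.19 ff.
* [Fulton1998] W. Fulton, Intersection Theory, 2nd ed. 1998, §19.1 eq. (3) and Lemma 19.1.1.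
-/

set_option linter.dupNamespace false

noncomputable section

open CategoryTheory Set TopologicalSpace Metric
open Literature.AlgebraicTopology.SingularHomology

namespace Summit.HodgeConjecture.HodgeConjecture.Theorems.HodgeBeyondAnchors

/-! ## Step 1: a box carried homeomorphically makes the pair map onto -/

/-- **A pair map carrying some subset homeomorphically onto a box of the target stratum is onto in
the critical degree.** Let `S' ⊆ U'` be closed, preconnected and straightened by charts of normal
dimension `≥ k ≥ 2` (`U'` second countable), `e` one such chart with a box
`B' = e.source ∩ e⁻¹ B((0,y),r)`, `f : U → U'` a map of pairs `(U, U ∖ S) → (U', U' ∖ S')`, and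
`ψ : B ≃ₜ B'` a homeomorphism from a subset `B ⊆ U` lifting `f` with `x ∈ S ↔ f x ∈ S'` on `B`. Then
`f_* : H_k(U | S; R) → H_k(U' | S'; R)` is surjective: the range of `B'` is everything
(`range_toAmbient_box_eq_top`), `ψ_*` is bijective, and `B → B' → U'` equals `B → U → U'`.
[cite: HatcherAT2002, §3.3 Lemma 3.27 and proof of Thm. 3.35] [cite: VoisinHodgeII2003, §9.2.4 proof of Lemma 9.22] -/
theorem surjective_relMap_of_homeomorph_box (R : Type) [CommRing R] {U U' : Type}
    [TopologicalSpace U] [TopologicalSpace U'] [SecondCountableTopology U'] {S : Set U} {S' : Set U'}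
    (hS' : IsClosed S') (hS'c : IsPreconnected S') {k : ℕ} (hk2 : 2 ≤ k)
    (hflat' : ∀ x ∈ S', ∃ (F : Type) (_ : NormedAddCommGroup F) (_ : NormedSpace ℝ F)
      (_ : FiniteDimensional ℝ F) (K : Type) (_ : NormedAddCommGroup K) (_ : NormedSpace ℝ K)
      (e : OpenPartialHomeomorph U' (F × K)),
      k ≤ Module.finrank ℝ F ∧ x ∈ e.source ∧ ∀ z ∈ e.source, z ∈ S' ↔ (e z).1 = 0)
    {F K : Type} [NormedAddCommGroup F] [NormedSpace ℝ F] [FiniteDimensional ℝ F]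
    [NormedAddCommGroup K] [NormedSpace ℝ K] (e : OpenPartialHomeomorph U' (F × K))
    (hkF : k ≤ Module.finrank ℝ F) (heS : ∀ z ∈ e.source, z ∈ S' ↔ (e z).1 = 0) (y : K) {r : ℝ}
    (hr : 0 < r) (hB : ball ((0 : F), y) r ⊆ e.target)
    (f : C(U, U')) (hf : MapsTo f Sᶜ S'ᶜ) {B : Set U} {B' : Set U'}
    (hB' : B' = e.source ∩ e ⁻¹' ball ((0 : F), y) r) (ψ : ↥B ≃ₜ ↥B')
    (hψf : ∀ x, ((ψ x : ↥B') : U') = f x) (hSS' : ∀ x : ↥B, (x : U) ∈ S ↔ f x ∈ S') :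
    Function.Surjective (relativeSingularHomology.map R R f hf k) := by
  have htop : LinearMap.range (localHomologyOfSet.toAmbient R R S' B' k).hom = ⊤ := by
    subst hB'
    exact range_toAmbient_box_eq_top R hS' hS'c hk2 hflat' e hkF heS y hr hB
  -- `ψ` as a homeomorphism of pairs `(B, B ∖ S) → (B', B' ∖ S')`
  have hpre : ψ ⁻¹' (Subtype.val ⁻¹' S' : Set ↥B')ᶜ = (Subtype.val ⁻¹' S : Set ↥B)ᶜ := by
    ext x
    simp only [mem_preimage, mem_compl_iff]
    rw [hψf x]
    exact not_congr (hSS' x).symm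
  have hψm : MapsTo (ψ : C(↥B, ↥B')) (Subtype.val ⁻¹' S : Set ↥B)ᶜ
      (Subtype.val ⁻¹' S' : Set ↥B')ᶜ := by
    intro x hx
    rw [← hpre] at hx
    exact hx
  have hψbij := relativeSingularHomology.bijective_map_homeomorph R R ψ hpre hψm k
  -- the square `B → B' → U'` = `B → U → U'`
  have hsq : relativeSingularHomology.map R R (ψ : C(↥B, ↥B')) hψm k ≫
      localHomologyOfSet.toAmbient R R S' B' k =
      localHomologyOfSet.toAmbient R R S B k ≫ relativeSingularHomology.map R R f hf k := by
    change relativeSingularHomology.map R R _ _ k ≫ relativeSingularHomology.map R R _ _ k =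
      relativeSingularHomology.map R R _ _ k ≫ relativeSingularHomology.map R R _ _ k
    rw [← relativeSingularHomology.map_comp, ← relativeSingularHomology.map_comp]
    exact LCube.relMap_congr R R (ContinuousMap.ext fun x ↦ by exact hψf x) _ _ k
  -- conclusion
  intro t
  have ht : t ∈ LinearMap.range (localHomologyOfSet.toAmbient R R S' B' k).hom := by
    rw [htop]
    exact Submodule.mem_top
  obtain ⟨w, hw⟩ := LinearMap.mem_range.1 ht
  obtain ⟨v, rfl⟩ := hψbij.2 w
  refine ⟨localHomologyOfSet.toAmbient R R S B k v, ?_⟩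
  rw [← ModuleCat.comp_apply, ← hsq, ModuleCat.comp_apply]
  exact hw

/-! ## Step 2: the Kronecker functional argument -/

/-- **If `H_k(U | S; 𝕜)` is a line, `f_* : H_k(U | S) → H_k(U' | S')` is onto and `b ≠ 0` dies on
`U' ∖ S'`, then the classes of `Hᵏ(U; 𝕜)` dying on `U ∖ S` are the multiples of `f^* b`** (over a
field `𝕜`). A class is its Kronecker functional (`kroneckerPairing_injective_of_field`, Hatcher
Thm. 3.2); a class dying on the complement pairs to zero with the kernel of
`ρ : H_k(U) → H_k(U | S)` (exactness of the pair), so `⟨x, –⟩` and `⟨f^* b, –⟩ = ⟨b, f_* –⟩`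
(`kroneckerPairing_map`, `ofAbsolute_comp_map`) are both determined by the coefficient of `ρ u` on
the generator `θ`; and `⟨f^* b, u₀⟩ ≠ 0` for `ρ u₀ = θ`, since otherwise `⟨b, –⟩` vanishes on all of
`H_k(U')` (every `ρ' v` is a multiple of `f_* θ = ρ' (f_* u₀)` by surjectivity), forcing `b = 0`.
[cite: HatcherAT2002, §3.1 Thm. 3.2 and §2.1 Thm. 2.16] [cite: Fulton1998, §19.1 eq. (3) and Lemma 19.1.1] -/
theorem ker_cohomologyMap_le_span_map_of_surjective {𝕜 : Type} [Field 𝕜] {U U' : Type}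
    [TopologicalSpace U] [TopologicalSpace U'] (S : Set U) (S' : Set U') (f : C(U, U'))
    (hf : MapsTo f Sᶜ S'ᶜ) (k : ℕ)
    (hθ : ∃ θ : localHomologyOfSet 𝕜 𝕜 U S k, ∀ x, x ∈ Submodule.span 𝕜 ({θ} : Set _))
    (hsurj : Function.Surjective (relativeSingularHomology.map 𝕜 𝕜 f hf k))
    {b : singularCohomology 𝕜 𝕜 U' k}
    (hb : singularCohomology.map 𝕜 𝕜 (subsetIncl S'ᶜ) k b = 0) (hb0 : b ≠ 0) :
    LinearMap.ker (singularCohomology.map 𝕜 𝕜 (subsetIncl Sᶜ) k).hom ≤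
      Submodule.span 𝕜 {singularCohomology.map 𝕜 𝕜 f k b} := by
  obtain ⟨θ, hθ⟩ := hθ
  set κ := kroneckerPairing 𝕜 𝕜 U k with hκ
  set κ' := kroneckerPairing 𝕜 𝕜 U' k with hκ'
  have hκinj : Function.Injective κ := kroneckerPairing_injective_of_field 𝕜 U k
  have hκ'inj : Function.Injective κ' := kroneckerPairing_injective_of_field 𝕜 U' k
  set ρ := relativeSingularHomology.ofAbsolute 𝕜 𝕜 U Sᶜ k with hρ
  set ρ' := relativeSingularHomology.ofAbsolute 𝕜 𝕜 U' S'ᶜ k with hρ'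
  set g := relativeSingularHomology.map 𝕜 𝕜 f hf k with hg
  set β := singularCohomology.map 𝕜 𝕜 f k b with hβ
  -- classes dying on the complement pair to zero with the kernel of `ρ`, `ρ'`
  have hvan : ∀ x ∈ LinearMap.ker (singularCohomology.map 𝕜 𝕜 (subsetIncl Sᶜ) k).hom,
      ∀ u, ρ u = 0 → κ x u = 0 := fun x hx u hu ↦
    kroneckerPairing_eq_zero_of_ofAbsolute_eq_zero 𝕜 𝕜 S x (LinearMap.mem_ker.1 hx) u hu
  have hvan' : ∀ v, ρ' v = 0 → κ' b v = 0 := fun v hv ↦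
    kroneckerPairing_eq_zero_of_ofAbsolute_eq_zero 𝕜 𝕜 S' b hb v hv
  -- naturality `ρ' (f_* u) = g (ρ u)` and `⟨β, u⟩ = ⟨b, f_* u⟩`
  have hnat : ∀ u, ρ' (singularHomology.map 𝕜 𝕜 f k u) = g (ρ u) := fun u ↦ by
    rw [← ModuleCat.comp_apply, ← relativeSingularHomology.ofAbsolute_comp_map, ModuleCat.comp_apply]
  have hβu : ∀ u, κ β u = κ' b (singularHomology.map 𝕜 𝕜 f k u) := fun u ↦
    kroneckerPairing_map f b u
  intro x hx
  by_cases hθW : ∃ u₀, ρ u₀ = θ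
  swap
  · -- `ρ = 0`: the functional of `x` vanishes, so `x = 0`
    have hρ0 : ∀ u, ρ u = 0 := by
      intro u
      obtain ⟨c, hc⟩ := Submodule.mem_span_singleton.1 (hθ (ρ u))
      by_cases hc0 : c = 0
      · rw [← hc, hc0, zero_smul]
      · exact absurd ⟨c⁻¹ • u, by rw [map_smul, ← hc, smul_smul, inv_mul_cancel₀ hc0, one_smul]⟩ hθW
    have hx0 : x = 0 := hκinj (by
      rw [map_zero]
      exact LinearMap.ext fun u ↦ hvan x hx u (hρ0 u))
    rw [hx0]
    exact Submodule.zero_mem _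
  obtain ⟨u₀, hu₀⟩ := hθW
  -- every `u` reduces to a multiple of `u₀` modulo `ker ρ`
  have hred : ∀ u, ∃ c : 𝕜, ρ (u - c • u₀) = 0 := fun u ↦ by
    obtain ⟨c, hc⟩ := Submodule.mem_span_singleton.1 (hθ (ρ u))
    exact ⟨c, by rw [map_sub, map_smul, hu₀, hc, sub_self]⟩
  -- `⟨β, u₀⟩ ≠ 0`, for otherwise `⟨b, –⟩ = 0`
  have hβ0 : κ β u₀ ≠ 0 := by
    intro h0
    apply hb0
    apply hκ'inj
    rw [map_zero]
    refine LinearMap.ext fun v ↦ ?_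
    obtain ⟨ℓ, hℓ⟩ := hsurj (ρ' v)
    obtain ⟨a, rfl⟩ := Submodule.mem_span_singleton.1 (hθ ℓ)
    have hz : ρ' (v - a • singularHomology.map 𝕜 𝕜 f k u₀) = 0 := by
      rw [map_sub, map_smul, hnat, hu₀, ← hℓ, map_smul, sub_self]
    have h1 := hvan' _ hz
    rw [map_sub, map_smul, sub_eq_zero, smul_eq_mul] at h1
    rw [LinearMap.zero_apply, h1, ← hβu, h0, mul_zero]
  -- `⟨x, –⟩` is proportional to `⟨β, –⟩`
  have hprop : ∀ u, κ x u = (κ x u₀ / κ β u₀) * κ β u := by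
    intro u
    obtain ⟨c, hc⟩ := hred u
    have h1 := hvan x hx _ hc
    have h2 : κ β (u - c • u₀) = 0 := by
      rw [hβu]
      refine hvan' _ ?_
      rw [hnat, hc, map_zero]
    rw [map_sub, map_smul, sub_eq_zero, smul_eq_mul] at h1 h2
    rw [h1, h2]
    field_simp
  refine Submodule.mem_span_singleton.2 ⟨κ x u₀ / κ β u₀, hκinj ?_⟩
  rw [map_smul]
  exact (LinearMap.ext fun u ↦ by rw [LinearMap.smul_apply, smul_eq_mul, hprop u]).symm

/-! ## Step 3: the geometry — restriction to the open subspaces and the pulled-back box -/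

/-- **Straightening charts restrict to open subspaces**: if `Ω ∩ Z` is straightened in `X` by charts
of normal dimension `≥ k`, then `Ω ∩ Z`, read as a subset of the subspace `Ω`, is straightened in `Ω`
(`OpenPartialHomeomorph.subtypeRestr`). [cite: HatcherAT2002, §3.3 Lemma 3.27] -/
theorem locallyFlat_subtypeVal_preimage {X : Type} [TopologicalSpace X] {Ω : Set X} (hΩ : IsOpen Ω)
    {Z : Set X} {k : ℕ}
    (hflat : ∀ x ∈ Ω ∩ Z, ∃ (F : Type) (_ : NormedAddCommGroup F) (_ : NormedSpace ℝ F)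
      (_ : FiniteDimensional ℝ F) (K : Type) (_ : NormedAddCommGroup K) (_ : NormedSpace ℝ K)
      (e : OpenPartialHomeomorph X (F × K)),
      k ≤ Module.finrank ℝ F ∧ x ∈ e.source ∧ ∀ z ∈ e.source, z ∈ Z ↔ (e z).1 = 0) :
    ∀ x ∈ (Subtype.val ⁻¹' Z : Set ↥Ω), ∃ (F : Type) (_ : NormedAddCommGroup F) (_ : NormedSpace ℝ F)
      (_ : FiniteDimensional ℝ F) (K : Type) (_ : NormedAddCommGroup K) (_ : NormedSpace ℝ K)
      (e : OpenPartialHomeomorph ↥Ω (F × K)),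
      k ≤ Module.finrank ℝ F ∧ x ∈ e.source ∧
        ∀ z ∈ e.source, z ∈ (Subtype.val ⁻¹' Z : Set ↥Ω) ↔ (e z).1 = 0 := by
  intro x hx
  obtain ⟨F, i₁, i₂, i₃, K, i₄, i₅, e, hkF, hxe, heS⟩ := hflat x.1 ⟨x.2, hx⟩
  have hne : Nonempty (⟨Ω, hΩ⟩ : Opens X) := ⟨⟨x.1, x.2⟩⟩
  let e' : OpenPartialHomeomorph ↥Ω (F × K) := e.subtypeRestr (s := ⟨Ω, hΩ⟩) hne
  have he's : e'.source = Subtype.val ⁻¹' e.source := OpenPartialHomeomorph.subtypeRestr_source e hne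
  have he'a : ∀ z : ↥Ω, e' z = e z.1 := fun z ↦ rfl
  refine ⟨F, i₁, i₂, i₃, K, i₄, i₅, e', hkF, ?_, ?_⟩
  · rw [he's]
    exact hxe
  · intro z hz
    rw [he's] at hz
    rw [he'a]
    exact heS z.1 hz

/-- `Ω ∩ Z` read in the subspace `Ω` is preconnected when `Ω ∩ Z` is. [folklore] -/
theorem isPreconnected_subtypeVal_preimage {X : Type} [TopologicalSpace X] {Ω Z : Set X}
    (h : IsPreconnected (Ω ∩ Z)) : IsPreconnected (Subtype.val ⁻¹' Z : Set ↥Ω) := by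
  rw [← Topology.IsInducing.subtypeVal.isPreconnected_image, Subtype.image_preimage_coe]
  exact h

/-- **(T) The topological Thom-line transport** (the heart of "`Z` appears with multiplicity one in
`φ⁻¹(φ Z)`", Voisin II §9.2.4 proof of Lemma 9.22, read in singular (co)homology; Fulton §19.1
eq. (3) and Lemma 19.1.1; Hatcher §3.3 Lemma 3.27 / proof of Thm. 3.35). Let `Ω ⊆ A`, `Ω' ⊆ A'` be
open in second-countable spaces, `Φ : A → A'` continuous with `Φ Ω ⊆ Ω'`, `Z ⊆ A`, `C ⊆ A'` closed
with `Φ Z ⊆ C` and `Ω ∩ Φ⁻¹ C ⊆ Z`, `Ω ∩ Z` and `Ω' ∩ C` preconnected and straightened by charts of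
normal real dimension `≥ k ≥ 2`, and suppose `Φ` agrees with an open partial homeomorphism
`e₀ : A ⇀ A'` near a point `P ∈ Ω ∩ Z ∩ e₀.source`. Then for every NON-ZERO `b ∈ Hᵏ(Ω'; 𝕜)` dying
on `Ω' ∖ C`, the classes of `Hᵏ(Ω; 𝕜)` dying on `Ω ∖ Z` are the multiples of `(Φ|_Ω)^* b`. Proof:
a small box `B'` of the straightening chart of `C` at `Φ P = e₀ P` (read in `Ω'`), inside the open
set where `e₀⁻¹` lands in `Ω` (`exists_box_subset`), is the homeomorphic image under `Φ` of
`B = e₀.source ∩ Φ⁻¹ B'` (inverse `e₀⁻¹`), so `Φ_* : H_k(Ω | Ω ∩ Z) → H_k(Ω' | Ω' ∩ C)` is onto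
(`surjective_relMap_of_homeomorph_box`); `H_k(Ω | Ω ∩ Z)` is a line
(`exists_forall_mem_span_localHomologyOfSet_of_locallyFlat`); conclude by the Kronecker functional
argument `ker_cohomologyMap_le_span_map_of_surjective`.
[cite: VoisinHodgeII2003, §9.2.4 proof of Lemma 9.22] [cite: HatcherAT2002, §3.3 Lemma 3.27 and proof of Thm. 3.35] [cite: Fulton1998, §19.1 eq. (3) and Lemma 19.1.1] -/
theorem stub_thomLineTransport :
    ∀ ⦃𝕜 : Type⦄ [Field 𝕜] ⦃A A' : Type⦄ [TopologicalSpace A] [TopologicalSpace A']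
      [SecondCountableTopology A] [SecondCountableTopology A']
      ⦃Ω : Set A⦄, IsOpen Ω → ∀ ⦃Ω' : Set A'⦄, IsOpen Ω' → ∀ (Φ : C(A, A')) (hΦ : Set.MapsTo Φ Ω Ω')
      ⦃Z : Set A⦄, IsClosed Z → ∀ ⦃C : Set A'⦄, IsClosed C → Set.MapsTo Φ Z C → Ω ∩ Φ ⁻¹' C ⊆ Z →
      IsPreconnected (Ω ∩ Z) → IsPreconnected (Ω' ∩ C) → ∀ ⦃k : ℕ⦄, 2 ≤ k →
      (∀ x ∈ Ω ∩ Z, ∃ (F : Type) (_ : NormedAddCommGroup F) (_ : NormedSpace ℝ F)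
        (_ : FiniteDimensional ℝ F) (K : Type) (_ : NormedAddCommGroup K) (_ : NormedSpace ℝ K)
        (e : OpenPartialHomeomorph A (F × K)),
        k ≤ Module.finrank ℝ F ∧ x ∈ e.source ∧ ∀ z ∈ e.source, z ∈ Z ↔ (e z).1 = 0) →
      (∀ y ∈ Ω' ∩ C, ∃ (F : Type) (_ : NormedAddCommGroup F) (_ : NormedSpace ℝ F)
        (_ : FiniteDimensional ℝ F) (K : Type) (_ : NormedAddCommGroup K) (_ : NormedSpace ℝ K)
        (e : OpenPartialHomeomorph A' (F × K)),
        k ≤ Module.finrank ℝ F ∧ y ∈ e.source ∧ ∀ z ∈ e.source, z ∈ C ↔ (e z).1 = 0) →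
      ∀ (e₀ : OpenPartialHomeomorph A A'), Set.EqOn Φ e₀ e₀.source →
      ∀ ⦃P : A⦄, P ∈ e₀.source → P ∈ Ω → P ∈ Z →
      ∀ ⦃b : singularCohomology 𝕜 𝕜 ↥Ω' k⦄,
        singularCohomology.map 𝕜 𝕜 (subsetIncl {y : ↥Ω' | (y : A') ∉ C}) k b = 0 → b ≠ 0 →
        LinearMap.ker (singularCohomology.map 𝕜 𝕜 (subsetIncl {x : ↥Ω | (x : A) ∉ Z}) k).hom ≤
          Submodule.span 𝕜 {singularCohomology.map 𝕜 𝕜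
            (⟨fun x ↦ ⟨Φ x, hΦ x.2⟩, by fun_prop⟩ : C(↥Ω, ↥Ω')) k b} := by
  intro 𝕜 _ A A' _ _ _ _ Ω hΩ Ω' hΩ' Φ hΦ Z hZ C hC hZC hCZ hZc hCc k hk2 hflat hflat' e₀ he₀ P hPe
    hPΩ hPZ b hb hb0
  -- the closed subsets `S = Ω ∩ Z`, `S' = Ω' ∩ C` of the subspaces `Ω`, `Ω'`
  set S : Set ↥Ω := Subtype.val ⁻¹' Z with hSdef
  set S' : Set ↥Ω' := Subtype.val ⁻¹' C with hS'def
  have hS : IsClosed S := hZ.preimage continuous_subtype_val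
  have hS' : IsClosed S' := hC.preimage continuous_subtype_val
  have hSc : IsPreconnected S := isPreconnected_subtypeVal_preimage hZc
  have hS'c : IsPreconnected S' := isPreconnected_subtypeVal_preimage hCc
  -- the map of pairs `f = Φ|_Ω : (Ω, Ω ∖ S) → (Ω', Ω' ∖ S')`
  set f : C(↥Ω, ↥Ω') := ⟨fun x ↦ ⟨Φ x, hΦ x.2⟩, by fun_prop⟩ with hfdef
  have hSS' : ∀ x : ↥Ω, x ∈ S ↔ f x ∈ S' := fun x ↦
    ⟨fun hx ↦ hZC hx, fun hx ↦ hCZ ⟨x.2, hx⟩⟩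
  have hf : MapsTo f Sᶜ S'ᶜ := fun x hx hx' ↦ hx ((hSS' x).2 hx')
  -- local flatness read in the subspaces, and the line `H_k(Ω | S) = 𝕜 · θ`
  have hflatU := locallyFlat_subtypeVal_preimage hΩ hflat
  have hflatU' := locallyFlat_subtypeVal_preimage hΩ' hflat'
  have hθ := exists_forall_mem_span_localHomologyOfSet_of_locallyFlat 𝕜 hS hSc hk2 hflatU
  -- the straightening chart of `S'` at `Φ P`
  have hP' : (⟨Φ P, hΦ hPΩ⟩ : ↥Ω') ∈ S' := hZC hPZ
  obtain ⟨F, i₁, i₂, i₃, K, i₄, i₅, e', hkF, hPe', he'S⟩ := hflatU' _ hP'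
  -- the open set of `Ω'` over which `e₀⁻¹` is defined and lands in `Ω`
  set O : Set ↥Ω' := {y | (y : A') ∈ e₀.target ∧ e₀.symm y ∈ Ω} with hOdef
  have hO : IsOpen O := (e₀.isOpen_inter_preimage_symm hΩ).preimage continuous_subtype_val
  have hPΦ : Φ P = e₀ P := he₀ hPe
  have hP'O : (⟨Φ P, hΦ hPΩ⟩ : ↥Ω') ∈ O := by
    refine ⟨?_, ?_⟩
    · change Φ P ∈ e₀.target
      rw [hPΦ]
      exact e₀.map_source hPe
    · change e₀.symm (Φ P) ∈ Ω
      rw [hPΦ, e₀.left_inv hPe]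
      exact hPΩ
  -- a small box `B'` of `e'` through `Φ P` inside `O`
  obtain ⟨r, hr, -, hBt, hBO, -⟩ := exists_box_subset e' he'S hP' hPe' hO hP'O zero_lt_one
  set y : K := (e' ⟨Φ P, hΦ hPΩ⟩).2 with hydef
  set B' : Set ↥Ω' := e'.source ∩ e' ⁻¹' ball ((0 : F), y) r with hB'def
  have hB'O : ∀ y' ∈ B', ((y' : A') ∈ e₀.target) ∧ e₀.symm y' ∈ Ω := fun y' hy' ↦ hBO hy'
  -- `f = e₀` on `e₀.source`
  have hfe₀ : ∀ x : ↥Ω, (x : A) ∈ e₀.source → (f x : A') = e₀ x := fun x hx ↦ he₀ hx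
  -- the subset `B = e₀.source ∩ f⁻¹ B'` of `Ω` and the homeomorphism `ψ : B ≃ₜ B'`
  set B : Set ↥Ω := {x | (x : A) ∈ e₀.source ∧ f x ∈ B'} with hBdef
  have hinv : ∀ y' : ↥B', (⟨e₀.symm (y' : ↥Ω'), (hB'O _ y'.2).2⟩ : ↥Ω) ∈ B := by
    intro y'
    have hyt : ((y' : ↥Ω') : A') ∈ e₀.target := (hB'O _ y'.2).1
    have hsrc : e₀.symm (y' : ↥Ω') ∈ e₀.source := e₀.map_target hyt
    have hfy : f ⟨e₀.symm (y' : ↥Ω'), (hB'O _ y'.2).2⟩ = (y' : ↥Ω') := by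
      apply Subtype.ext
      rw [hfe₀ _ hsrc]
      exact e₀.right_inv hyt
    exact ⟨hsrc, by rw [hfy]; exact y'.2⟩
  have hcont : Continuous fun y' : ↥B' ↦ e₀.symm ((y' : ↥Ω') : A') :=
    e₀.continuousOn_symm.comp_continuous (f := fun y' : ↥B' ↦ ((y' : ↥Ω') : A')) (by fun_prop)
      fun y' ↦ (hB'O _ y'.2).1
  let ψ : ↥B ≃ₜ ↥B' :=
    { toFun := fun x ↦ ⟨f x, x.2.2⟩
      invFun := fun y' ↦ ⟨⟨e₀.symm (y' : ↥Ω'), (hB'O _ y'.2).2⟩, hinv y'⟩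
      left_inv := fun x ↦ by
        apply Subtype.ext
        apply Subtype.ext
        change e₀.symm (f x : A') = (x : A)
        rw [hfe₀ _ x.2.1, e₀.left_inv x.2.1]
      right_inv := fun y' ↦ by
        apply Subtype.ext
        apply Subtype.ext
        change Φ (e₀.symm (y' : ↥Ω')) = ((y' : ↥Ω') : A')
        rw [he₀ (e₀.map_target (hB'O _ y'.2).1)]
        exact e₀.right_inv (hB'O _ y'.2).1
      continuous_toFun := (f.continuous.comp continuous_subtype_val).subtype_mk _
      continuous_invFun := (hcont.subtype_mk _).subtype_mk _ }
  have hψf : ∀ x, ((ψ x : ↥B') : ↥Ω') = f x := fun _ ↦ rfl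
  have hSS'B : ∀ x : ↥B, (x : ↥Ω) ∈ S ↔ f x ∈ S' := fun x ↦ hSS' x
  -- `f_* : H_k(Ω | S) → H_k(Ω' | S')` is onto
  have hsurj := surjective_relMap_of_homeomorph_box 𝕜 hS' hS'c hk2 hflatU' e' hkF he'S y hr hBt f hf
    hB'def ψ hψf hSS'B
  -- the Kronecker functional argument
  exact ker_cohomologyMap_le_span_map_of_surjective S S' f hf k hθ hsurj hb hb0

end Summit.HodgeConjecture.HodgeConjecture.Theorems.HodgeBeyondAnchors

end
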